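import Literature.NumberTheory.EllipticCurves.BSDConductorNonsplitNodeProofs
import HarnessLib

/-!
# The conductor schemas fail at `y² = x³ + p x²` for every prime `p ≠ ℓ` — hence for every prime `ℓ`

Sibling proof file (theorems only) of `NonsplitNodeConductor` and `BSDConductorNonsplitNodeProofs`
(trunk EllArithM, item C15; bsd.S15).  Those files refute the five uncorrected conductor schemas
`WeierstrassCurve.artinConductor_tate_eq_conductor W ℓ`,
`WeierstrassCurve.artinConductorExponent_tate_eq_conductorExponent W ℓ`,
`WeierstrassCurve.conductorNatOf_geomPoints_eq_conductorNorm W ℓ` (`HasseWeilAbelian`),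
`conductor_eq_conductorOf_mul W ℓ`, `conductorNorm_eq_artinConductorNat W ℓ` (`BSDConductor`) at the
non-split node `y² = x³ + 3x²` over `ℚ`, for the primes `ℓ ≠ 3`.  This file runs the same
computation for the whole family `W_p = WeierstrassCurve.nodalCubic p : y² = x³ + p x²`, `p` prime,
and closes the remaining case `ℓ = 3` (witness `p = 2`):

* `conductorOf_nodalCubic_ne_one`: for primes `p ≠ ℓ`, `𝔣^{(ℓ)}(V_ℓ(E_ns(ℚ̄))) ⊆ (p) ≠ (1)`
  (`V_ℓ(E_ns) ≅ ℚ_ℓ(1) ⊗ χ_{ℚ(√p)}` is ramified at `p`: the tree's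
  `exists_mem_inertia_smul_eq_neg_of_sq_eq_prime`, `one_le_conductorExponentOf`,
  `conductorExponentOf_eq_zero`);
* `not_artinConductor_tate_eq_conductor_nodalCubic` and its four analogues: the schemas fail at
  `W_p` for all primes `p ≠ ℓ`;
* `not_forall_artinConductor_tate_eq_conductor ℓ` and its four analogues: **for every prime `ℓ`**
  the schema over all `W : WeierstrassCurve ℚ` is false — so none of the five named facts admits a
  `_holds` theorem at any `ℓ`; their printed content (Serre–Tate 1968, §2.1; Silverman *ATAEC*
  §IV.10–11, elliptic curves only) is carried by the corrected `…_of_isElliptic` facts.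

## References

* J. H. Silverman, *The Arithmetic of Elliptic Curves*, 2nd ed., GTM 106 (2009), Prop. III.2.5,
  Exercise 3.5 (non-split node). [SilvermanAEC2009]
* J.-P. Serre, J. Tate, *Good reduction of abelian varieties*, Ann. of Math. 88 (1968), §2.1
  (conductor of an `ℓ`-adic representation). [SerreTate1968]
* J. H. Silverman, *Advanced Topics in the Arithmetic of Elliptic Curves*, GTM 151 (1994),
  §IV.10 (conductor of an elliptic curve). [SilvermanATAEC1994]

## Design

Theorems only; `noncomputable section`, `open scoped Classical` as in the node files.  Everything
Galois-theoretic is imported (`NonsplitNode*`, `QuadraticInertia`); new here is only the bookkeeping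
for a general prime `p` (places of `ℚ` above `p` versus `ℓ`, support of the `finprod`).
-/

noncomputable section

open scoped Classical NumberField
open Field IsDedekindDomain WeierstrassCurve WeierstrassCurve.nodalCubic

namespace Literature.NumberTheory.EllipticCurves

open GaloisRepresentations

/-! ### Places of `ℚ` above distinct rational primes -/

/-- The place `v_p` of `ℚ` above the rational prime `p` exists (`Rat.HeightOneSpectrum.primesEquiv`).
[folklore] -/
theorem exists_natCast_mem_asIdeal {p : ℕ} (hp : p.Prime) :
    ∃ v : HeightOneSpectrum (𝓞 ℚ), (p : 𝓞 ℚ) ∈ v.asIdeal :=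
  ⟨(Rat.HeightOneSpectrum.primesEquiv (R := 𝓞 ℚ)).symm ⟨p, hp⟩,
    (natCast_mem_asIdeal_iff_eq_primesEquiv_symm _ hp).mpr rfl⟩

/-- Distinct rational primes lie in distinct places: `ℓ ∉ v_p` for `ℓ ≠ p`. [folklore] -/
theorem natCast_notMem_asIdeal {p ℓ : ℕ} (hp : p.Prime) (hℓ : ℓ.Prime) (hpℓ : p ≠ ℓ)
    {v : HeightOneSpectrum (𝓞 ℚ)} (hv : (p : 𝓞 ℚ) ∈ v.asIdeal) : (ℓ : 𝓞 ℚ) ∉ v.asIdeal := by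
  intro hℓv
  have e1 := (natCast_mem_asIdeal_iff_eq_primesEquiv_symm v hp).mp hv
  have e2 := (natCast_mem_asIdeal_iff_eq_primesEquiv_symm v hℓ).mp hℓv
  rw [e1] at e2
  have := congrArg Subtype.val ((Rat.HeightOneSpectrum.primesEquiv (R := 𝓞 ℚ)).symm.injective e2)
  exact hpℓ this

/-! ### The prime-to-`ℓ` Artin conductor of `V_ℓ(E_ns)` for `W_p`, `p ≠ ℓ` -/

section Conductor

variable {p ℓ : ℕ} [hp : Fact p.Prime] [Fact ℓ.Prime]

/-- `2p ≠ 0` in `ℚ`: the cubic `y² = x³ + p x²` has a node. [folklore] -/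
theorem two_mul_natCast_prime_ne_zero : (2 : ℚ) * p ≠ 0 :=
  mul_ne_zero two_ne_zero (Nat.cast_ne_zero.mpr hp.out.ne_zero)

/-- A continuity proof `h` for the Galois action on `V_ℓ(E_ns)` of `W_p` (the schemas quantify over
such `h`; one exists, `nodalCubic.continuous_rationalTateRepresentation`). [folklore] -/
theorem continuous_rationalTateRepresentation_nodalCubic :
    Continuous fun x : absoluteGaloisGroup ℚ × RationalTateModule (geomPoints (nodalCubic (p : ℚ))) ℓ ↦
      rationalTateRepresentation (absoluteGaloisGroup ℚ) (geomPoints (nodalCubic (p : ℚ))) ℓ x.1 x.2 :=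
  nodalCubic.continuous_rationalTateRepresentation ℓ two_mul_natCast_prime_ne_zero

/-- **`𝔣^{(ℓ)}(V_ℓ(E_ns)) ≠ 1` for `W_p : y² = x³ + p x²`, `p ≠ ℓ` primes.**  The conductor
exponents of the rational Tate module of the node vanish at every `v ∌ 2p, ℓ`
(`nodalCubic.conductorExponentOf_eq_zero`: unramified away from `4pℓ`), so the `finprod`
`conductorOf` is a genuine finite product over the places dividing `2p` (Mathlib
`Ideal.finite_factors`); at `v_p ∌ ℓ` the exponent is `≥ 1` (`nodalCubic.one_le_conductorExponentOf`,
fed with the inertia elements negating `√p` of `exists_mem_inertia_smul_eq_neg_of_sq_eq_prime`: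
`p` ramifies in `ℚ(√p)`), so the product is contained in `v_p ≠ ⊤`.  Informally
`V_ℓ(E_ns) ≅ ℚ_ℓ(1) ⊗ χ_{ℚ(√p)}` has conductor divisible by `p`.  Serre–Tate (1968), §2.1;
Silverman, *AEC*, Exercise 3.5. [cite: SilvermanAEC2009, Prop. III.2.5 and Exercise 3.5] -/
theorem conductorOf_nodalCubic_ne_one (hpℓ : p ≠ ℓ)
    (h : Continuous fun x : absoluteGaloisGroup ℚ ×
        RationalTateModule (geomPoints (nodalCubic (p : ℚ))) ℓ ↦
      rationalTateRepresentation (absoluteGaloisGroup ℚ) (geomPoints (nodalCubic (p : ℚ))) ℓ x.1 x.2) :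
    conductorOf (geomPoints (nodalCubic (p : ℚ))) ℓ h ≠ 1 := by
  have hprime : p.Prime := hp.out
  have hℓ : ℓ.Prime := Fact.out
  have hb : algebraMap (𝓞 ℚ) ℚ (p : 𝓞 ℚ) = (p : ℚ) := map_natCast _ p
  have ha : (2 : ℚ) * p ≠ 0 := two_mul_natCast_prime_ne_zero
  set M := geomPoints (nodalCubic (p : ℚ)) with hM
  set f : HeightOneSpectrum (𝓞 ℚ) → Ideal (𝓞 ℚ) := fun v =>
    if (ℓ : 𝓞 ℚ) ∈ v.asIdeal then 1 else v.asIdeal ^ conductorExponentOf M ℓ h v with hf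
  -- the support of `f` lies in the finite set of places dividing `2p`
  have h2p : Ideal.span {(2 * p : 𝓞 ℚ)} ≠ ⊥ := by
    rw [Ne, Ideal.span_singleton_eq_bot]
    exact mul_ne_zero two_ne_zero (Nat.cast_ne_zero.mpr hprime.ne_zero)
  have hsupp : Function.mulSupport f ⊆
      {v : HeightOneSpectrum (𝓞 ℚ) | v.asIdeal ∣ Ideal.span {(2 * p : 𝓞 ℚ)}} := by
    intro v hv
    rw [Function.mem_mulSupport] at hv
    rw [Set.mem_setOf_eq, Ideal.dvd_span_singleton]
    by_contra hv2p
    apply hv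
    by_cases hvℓ : (ℓ : 𝓞 ℚ) ∈ v.asIdeal
    · simp only [hf, if_pos hvℓ]
    · simp only [hf, if_neg hvℓ]
      have hv4p : 4 * (p : 𝓞 ℚ) ∉ v.asIdeal := by
        intro hmem
        have h22 : (4 : 𝓞 ℚ) * p = 2 * (2 * p) := by ring
        rw [h22] at hmem
        rcases v.isPrime.mem_or_mem hmem with h2 | h2
        · exact hv2p (by simpa only [mul_comm] using v.asIdeal.mul_mem_left (p : 𝓞 ℚ) h2)
        · exact hv2p h2
      rw [nodalCubic.conductorExponentOf_eq_zero hb ℓ ha h hv4p hvℓ, pow_zero]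
  have hfin : (Function.mulSupport f).Finite := (Ideal.finite_factors h2p).subset hsupp
  -- the place above `p` and its factor
  obtain ⟨w, hw⟩ := exists_natCast_mem_asIdeal hprime
  have hwℓ : (ℓ : 𝓞 ℚ) ∉ w.asIdeal := natCast_notMem_asIdeal hprime hℓ hpℓ hw
  have hprod : conductorOf M ℓ h = ∏ v ∈ insert w hfin.toFinset, f v := by
    change ∏ᶠ v, f v = _
    exact finprod_eq_prod_of_mulSupport_subset f fun v hv => by
      simp only [Finset.coe_insert, Set.Finite.coe_toFinset, Set.mem_insert_iff]
      exact Or.inr hv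
  have hdvd : f w ∣ conductorOf M ℓ h := by
    rw [hprod]
    exact Finset.dvd_prod_of_mem f (Finset.mem_insert_self w _)
  have hfw : f w = w.asIdeal ^ conductorExponentOf M ℓ h w := by simp only [hf, if_neg hwℓ]
  -- `a_{v_p} ≥ 1`: inertia elements above `p` negating `√p`
  have hs : sqrt (p : ℚ) ^ 2 = ((p : ℕ) : AlgebraicClosure ℚ) := by rw [sqrt_sq, map_natCast]
  have hone : 1 ≤ conductorExponentOf M ℓ h w :=
    nodalCubic.one_le_conductorExponentOf ℓ ha (Nat.cast_ne_zero.mpr hℓ.ne_zero) h hwℓ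
      fun 𝔓 h𝔓 ↦ exists_mem_inertia_smul_eq_neg_of_sq_eq_prime hprime hs hw h𝔓
  rw [hfw] at hdvd
  intro h1
  have hle : conductorOf M ℓ h ≤ w.asIdeal :=
    (Ideal.le_of_dvd hdvd).trans (Ideal.pow_le_self (Nat.one_le_iff_ne_zero.mp hone))
  rw [h1, Ideal.one_eq_top, top_le_iff] at hle
  exact w.isPrime.ne_top hle

end Conductor

/-! ### The five schemas fail at `W_p`, `p ≠ ℓ` -/

section Nodal

variable {p ℓ : ℕ} [hp : Fact p.Prime] [Fact ℓ.Prime]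

/-- **The C15 ideal schema fails at `y² = x³ + p x²`** (`p ≠ ℓ` primes): that instance says
`𝔣^{(ℓ)}(V_ℓ(E_ns(ℚ̄))) = 1` (`artinConductor_tate_eq_conductor_iff_of_Δ_eq_zero`), against
`conductorOf_nodalCubic_ne_one`.  Faithful form:
`WeierstrassCurve.artinConductor_tate_eq_conductor_of_isElliptic`; the case `p = 3` is
`not_artinConductor_tate_eq_conductor_nodalCubic_three`.
[cite: SilvermanAEC2009, Prop. III.2.5 and Exercise 3.5] -/
theorem not_artinConductor_tate_eq_conductor_nodalCubic (hpℓ : p ≠ ℓ) :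
    ¬ (nodalCubic (p : ℚ)).artinConductor_tate_eq_conductor ℓ := by
  intro H
  rw [artinConductor_tate_eq_conductor_iff_of_Δ_eq_zero _ ℓ (nodalCubic.Δ_eq (p : ℚ))] at H
  exact conductorOf_nodalCubic_ne_one hpℓ _ (H continuous_rationalTateRepresentation_nodalCubic)

/-- **The C15 exponent schema fails at `y² = x³ + p x²`** (`p ≠ ℓ` primes), through
`WeierstrassCurve.artinConductor_tate_eq_conductor_of_exponent`.  Faithful form:
`WeierstrassCurve.artinConductorExponent_tate_eq_conductorExponent_of_isElliptic`.
[cite: SilvermanAEC2009, Prop. III.2.5 and Exercise 3.5] -/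
theorem not_artinConductorExponent_tate_eq_conductorExponent_nodalCubic (hpℓ : p ≠ ℓ) :
    ¬ (nodalCubic (p : ℚ)).artinConductorExponent_tate_eq_conductorExponent ℓ :=
  fun hA => not_artinConductor_tate_eq_conductor_nodalCubic hpℓ
    (WeierstrassCurve.artinConductor_tate_eq_conductor_of_exponent _ ℓ hA)

/-- **The C15 numerical schema fails at `y² = x³ + p x²`** (`p ≠ ℓ` primes): `N(W_p) = 1` (junk,
`conductorNorm_eq_one_of_Δ_eq_zero'`), so the schema says `#(𝓞 ℚ ⧸ 𝔣^{(ℓ)}) = 1`, i.e.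
`𝔣^{(ℓ)} = ⊤` (Mathlib `Ideal.absNorm_eq_one_iff`).  Faithful form:
`WeierstrassCurve.conductorNatOf_geomPoints_eq_conductorNorm_of_isElliptic`.
[cite: SilvermanAEC2009, Prop. III.2.5 and Exercise 3.5] -/
theorem not_conductorNatOf_geomPoints_eq_conductorNorm_nodalCubic (hpℓ : p ≠ ℓ) :
    ¬ (nodalCubic (p : ℚ)).conductorNatOf_geomPoints_eq_conductorNorm ℓ := by
  intro H
  have hN : (nodalCubic (p : ℚ)).conductorNorm ℤ = 1 :=
    (nodalCubic (p : ℚ)).conductorNorm_eq_one_of_Δ_eq_zero' ℤ (nodalCubic.Δ_eq (p : ℚ))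
  have h := continuous_rationalTateRepresentation_nodalCubic (p := p) (ℓ := ℓ)
  have e := H h (by rw [hN]; exact (Fact.out : ℓ.Prime).not_dvd_one)
  rw [hN] at e
  unfold conductorNatOf at e
  exact conductorOf_nodalCubic_ne_one hpℓ h
    ((Ideal.absNorm_eq_one_iff.mp e).trans Ideal.one_eq_top.symm)

/-- **The bsd.S15 ideal schema fails at `y² = x³ + p x²`** (`p ≠ ℓ` primes): at `Δ = 0` it
coincides with the C15 ideal schema
(`conductor_eq_conductorOf_mul_iff_artinConductor_tate_eq_conductor_of_Δ_eq_zero`).  Faithful form: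
`conductor_eq_conductorOf_mul_of_isElliptic`. [cite: SilvermanAEC2009, Prop. III.2.5 and Exercise 3.5] -/
theorem not_conductor_eq_conductorOf_mul_nodalCubic (hpℓ : p ≠ ℓ) :
    ¬ conductor_eq_conductorOf_mul (nodalCubic (p : ℚ)) ℓ :=
  fun H => not_artinConductor_tate_eq_conductor_nodalCubic hpℓ
    ((conductor_eq_conductorOf_mul_iff_artinConductor_tate_eq_conductor_of_Δ_eq_zero _ ℓ
      (nodalCubic.Δ_eq (p : ℚ))).mp H)

/-- **The bsd.S15 numerical schema fails at `y² = x³ + p x²`** (`p ≠ ℓ` primes): `N = 1`, `ℓ ∤ 1`,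
but `N^{(ℓ)}(V_ℓ(E_ns)) ≠ 1`.  Faithful form: `conductorNorm_eq_artinConductorNat_of_isElliptic`.
[cite: SilvermanAEC2009, Prop. III.2.5 and Exercise 3.5] -/
theorem not_conductorNorm_eq_artinConductorNat_nodalCubic (hpℓ : p ≠ ℓ) :
    ¬ conductorNorm_eq_artinConductorNat (nodalCubic (p : ℚ)) ℓ := by
  intro H
  have hN : (nodalCubic (p : ℚ)).conductorNorm ℤ = 1 :=
    (nodalCubic (p : ℚ)).conductorNorm_eq_one_of_Δ_eq_zero' ℤ (nodalCubic.Δ_eq (p : ℚ))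
  have h := continuous_rationalTateRepresentation_nodalCubic (p := p) (ℓ := ℓ)
  have e := H h (by rw [hN]; exact (Fact.out : ℓ.Prime).not_dvd_one)
  rw [hN] at e
  unfold conductorNatOf at e
  exact conductorOf_nodalCubic_ne_one hpℓ h
    ((Ideal.absNorm_eq_one_iff.mp e.symm).trans Ideal.one_eq_top.symm)

end Nodal

/-! ### For every prime `ℓ`: the schemas over all `W : WeierstrassCurve ℚ` are false -/

section EveryPrime

variable (ℓ : ℕ) [Fact ℓ.Prime]

omit [Fact ℓ.Prime] in
/-- A prime `p ≠ ℓ` (namely `2`, or `3` when `ℓ = 2`). [folklore] -/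
theorem exists_prime_ne : ∃ p : ℕ, p.Prime ∧ p ≠ ℓ := by
  by_cases h2 : ℓ = 2
  · exact ⟨3, Nat.prime_three, by omega⟩
  · exact ⟨2, Nat.prime_two, Ne.symm h2⟩

/-- **For every prime `ℓ` the C15 ideal schema over all `W : WeierstrassCurve ℚ` is false**; in
particular `WeierstrassCurve.artinConductor_tate_eq_conductor` admits no `_holds` theorem at any
`ℓ` (the case `ℓ ≠ 3` is `not_artinConductor_tate_eq_conductor_nodalCubic_three`).
[cite: SilvermanAEC2009, Prop. III.2.5 and Exercise 3.5] -/
theorem not_forall_artinConductor_tate_eq_conductor :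
    ¬ ∀ W : WeierstrassCurve ℚ, W.artinConductor_tate_eq_conductor ℓ := by
  obtain ⟨p, hp, hpℓ⟩ := exists_prime_ne ℓ
  haveI : Fact p.Prime := ⟨hp⟩
  exact fun H => not_artinConductor_tate_eq_conductor_nodalCubic hpℓ (H _)

/-- For every prime `ℓ`, the C15 exponent schema over all `W : WeierstrassCurve ℚ` is false.
[cite: SilvermanAEC2009, Prop. III.2.5 and Exercise 3.5] -/
theorem not_forall_artinConductorExponent_tate_eq_conductorExponent :
    ¬ ∀ W : WeierstrassCurve ℚ, W.artinConductorExponent_tate_eq_conductorExponent ℓ := by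
  obtain ⟨p, hp, hpℓ⟩ := exists_prime_ne ℓ
  haveI : Fact p.Prime := ⟨hp⟩
  exact fun H => not_artinConductorExponent_tate_eq_conductorExponent_nodalCubic hpℓ (H _)

/-- For every prime `ℓ`, the C15 numerical schema over all `W : WeierstrassCurve ℚ` is false.
[cite: SilvermanAEC2009, Prop. III.2.5 and Exercise 3.5] -/
theorem not_forall_conductorNatOf_geomPoints_eq_conductorNorm :
    ¬ ∀ W : WeierstrassCurve ℚ, W.conductorNatOf_geomPoints_eq_conductorNorm ℓ := by
  obtain ⟨p, hp, hpℓ⟩ := exists_prime_ne ℓ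
  haveI : Fact p.Prime := ⟨hp⟩
  exact fun H => not_conductorNatOf_geomPoints_eq_conductorNorm_nodalCubic hpℓ (H _)

/-- For every prime `ℓ`, the bsd.S15 ideal schema over all `W : WeierstrassCurve ℚ` is false
(the form quantifying over `ℓ` as well is `not_forall_conductor_eq_conductorOf_mul`).
[cite: SilvermanAEC2009, Prop. III.2.5 and Exercise 3.5] -/
theorem not_forall_conductor_eq_conductorOf_mul_of_prime :
    ¬ ∀ W : WeierstrassCurve ℚ, conductor_eq_conductorOf_mul W ℓ := by
  obtain ⟨p, hp, hpℓ⟩ := exists_prime_ne ℓ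
  haveI : Fact p.Prime := ⟨hp⟩
  exact fun H => not_conductor_eq_conductorOf_mul_nodalCubic hpℓ (H _)

/-- For every prime `ℓ`, the bsd.S15 numerical schema over all `W : WeierstrassCurve ℚ` is false.
[cite: SilvermanAEC2009, Prop. III.2.5 and Exercise 3.5] -/
theorem not_forall_conductorNorm_eq_artinConductorNat :
    ¬ ∀ W : WeierstrassCurve ℚ, conductorNorm_eq_artinConductorNat W ℓ := by
  obtain ⟨p, hp, hpℓ⟩ := exists_prime_ne ℓ
  haveI : Fact p.Prime := ⟨hp⟩
  exact fun H => not_conductorNorm_eq_artinConductorNat_nodalCubic hpℓ (H _)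

end EveryPrime

end Literature.NumberTheory.EllipticCurves
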